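import Summits.BirchSwinnertonDyer.Rank1Residual.X2.CongruenceTransferSqueeze
import Summits.BirchSwinnertonDyer.Rank1Residual.X1.RankZero
import HarnessLib

/-!
# Class X2 (odd multiplicative Eisenstein prime): ROUTE G at `p ‖ N` — cell forms and the headline
# compositions "a CLOSED congruent relative (X1 or X2) ⇒ Mazur's main conjecture / `BSD(E,p)` at
# the X2 pair", and the converse service "a closed X2 relative ⇒ `BSD(E,p)` on the X1 leaf"
# (cell `b2b-bsdres`, unit `b2b-bsdres-eisenstein-p2`, gen 7)

HONEST FRAMING (run/shared/lean/b2b/bsd-rank1-residual/, verbatim in every file): the goal of the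
cell is to DELETE the COMBINATION-SHAPED residual classes of the Birch–Swinnerton-Dyer formula for
ALL analytic-rank `≤ 1` elliptic curves over `ℚ` — "full BSD formula for every rank `≤ 1` curve in
class `C`" assembled STRICTLY from published theorems — so that the rank-`≤ 1` remainder becomes
exactly the CONSTRUCTION-SHAPED classes, which are TYPED (missing-input `Prop`s), NOT attempted.
This is not "finishing BSD". Research routes; NO CLAIM BEYOND STATED CLASSES; nothing here changes
a label; X2b and X2c stay CONSTRUCTION-SHAPED (route G is a per-pair CERTIFICATE route: its
transfer statement `CongruentLambdaShift` is a typed input supplied outside the kernel). Theorems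
only (no definition, no named fact): the published theorems enter as the tree's existing NAMED
FACTS, taken as hypotheses — Wuthrich 2014 Thm. 16 (`hWu` multiplicative / `hW16` good ordinary),
Stein–Wuthrich 2013 Thm. 6.1 (`hJs hJn hHs hHn`), Greenberg–Stevens (`hGS`), Greenberg 1999 Thm. 4.1
(`hGr`), Gross–Zagier–Kolyvagin (`hGZK`), modularity (`hmod`, `hpar`).

Contents (all at an odd prime `p`; "closed relative" = a pair where the cell's data give Mazur's
main conjecture — per pair, nothing booked):
* `bsdp_of_algebraicInvariantsEq_rankZero`, `missingInputB_of_cellB_of_algebraicInvariantsEq`,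
  `cellC_mazurMainConjectureAt_of_algebraicInvariantsEq` — the forms of route G's output;
* `algebraicInvariantsEq_of_closedRelative_mult` / `…_goodOrd` — X2 TARGET, closed X2 / X1 RELATIVE:
  the transferred invariants;
* `bsdp_of_closedRelative_mult_rankZero` / `bsdp_of_closedRelative_goodOrd_rankZero` — HEADLINE at
  `r = 0` (census `N < 2·10⁴`, `p = 3`: 28 X2b pairs beyond lamMin/P/T, e.g. `1452e1@3` from the
  route-P pair `66a1@3`, `6510bd1@3` from the X1 leaf pair `434b1@3`);
* `lambdaPartAt_of_algebraicInvariantsEq`, `Leaf.bsdp_of_algebraicInvariantsEq` — X1 TARGET (for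
  sub-cells eisenstein-p1 / x1a / x1b: the X1 leaf may use closed X2 relatives; census: 30 rank-0
  and 25 rank-1 X1 classes at `p = 3` close ONLY through an X2 relative, e.g. the `44a` family from
  `66a1@3`).

References: [GreenbergVatsal2000] §2 pp. 14–15, 20–27; [Wuthrich2014] Thm. 16; [GreenbergLNM1716]
Thm. 4.1; [SteinWuthrich2013] Thm. 6.1; HOME/b2b-bsdres-eisenstein-p2/X2-GAP.md §12, routeG/.
-/

set_option autoImplicit false

noncomputable section

open scoped Classical MatrixGroups ModularForm

open PowerSeries CongruenceSubgroup WeierstrassCurve Literature.NumberTheory.EllipticCurves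
  Literature.NumberTheory.EllipticCurves.ModularForms
  Literature.NumberTheory.EllipticCurves.Rank1Residual
  Literature.NumberTheory.EllipticCurves.Rank1Residual.Typed
  Literature.NumberTheory.EllipticCurves.Wuthrich2014
  Literature.NumberTheory.EllipticCurves.SteinWuthrich2013
  Literature.NumberTheory.EllipticCurves.Greenberg1999
  Summit.BirchSwinnertonDyer.BirchSwinnertonDyer.Theorems.Rank1ResidualX1Defs
  Summit.BirchSwinnertonDyer.Rank1Residual.X1.MuLambda
  Summit.BirchSwinnertonDyer.Rank1Residual.X1.MuPart
  Summit.BirchSwinnertonDyer.Rank1Residual.X1.ParitySqueeze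
  Summit.BirchSwinnertonDyer.Rank1Residual.X1.TamagawaSqueeze
  Summit.BirchSwinnertonDyer.Rank1Residual.X1.CongruenceTransfer

namespace Summit.BirchSwinnertonDyer.Rank1Residual.X2

/-! ## §1. The forms of route G's output at an X2 pair -/

section Forms

variable {W : WeierstrassCurve ℚ} [W.IsElliptic] [W.IsGloballyMinimal] {p : ℕ} [Fact p.Prime]

/-- **Route G, rank `0`: `μ_an = 0 ∧ λ_an = n ∧ (μ_alg, λ_alg) = (0, k) ∧ n ≤ k + e_p ⇒ BSD(E,p)`** at
an odd multiplicative Eisenstein prime (through gen 1's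
`bsdp_of_mazurMainConjectureAt_of_analyticRank_eq_zero`: Stein–Wuthrich Thm. 6.1, GZK, modularity,
Greenberg–Stevens). [cite: Wuthrich2014, Thm. 16 (p. 397)] [cite: SteinWuthrich2013, Thm. 6.1 (p. 20)]
[cite: GreenbergVatsal2000, §2 p. 27] -/
theorem bsdp_of_algebraicInvariantsEq_rankZero
    (hWu : thm16_charIdeal_dvd_multiplicative_of_reducible)
    (hJs : thm61_splitMultiplicative) (hJn : thm61_nonsplitMultiplicative)
    (hHs : exists_isSplitMultCanonical) (hHn : exists_isMultCanonical)
    (hGZK : rank_eq_analyticRank_of_analyticRank_le_one) (hmod : hasEntireLFunction_rat)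
    (hpar : nonempty_modularParametrizationData)
    (W : WeierstrassCurve ℚ) [W.IsElliptic] [W.IsGloballyMinimal] (p : ℕ) [Fact p.Prime]
    (hGS : greenberg_stevens (W := W) (p := p))
    (hp2 : p ≠ 2) (hmult : W.HasMultiplicativeReductionAtPrime p)
    (hred : ¬ W.HasIrreducibleModPGaloisRep p) (hr : W.analyticRank = 0) {n k : ℕ}
    (hμ0 : AnalyticMuLE W p 0) (hlam : AnalyticLambdaEq W p n) (hinv : AlgebraicInvariantsEq W p k)
    (hkN : ¬ W.HasSplitMultiplicativeReductionAtPrime p → n ≤ k)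
    (hkS : W.HasSplitMultiplicativeReductionAtPrime p → n ≤ k + 1) : BSDp W p :=
  bsdp_of_mazurMainConjectureAt_of_analyticRank_eq_zero hJs hJn hHs hHn hGZK hmod hpar W p hGS hp2
    hmult hr (mazurMainConjectureAt_of_algebraicInvariantsEq hWu W p hp2 hmult hred hμ0 hlam hinv hkN hkS)

/-- **Sub-cell X2b: the typed missing input `X2.MissingInputB W p`** from `μ_an = 0`, `λ_an = n`,
`(μ_alg, λ_alg) = (0, k)`, `n ≤ k + e_p`. [cite: Wuthrich2014, Thm. 16 (p. 397)] [cite: GreenbergVatsal2000, §2 p. 27] -/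
theorem missingInputB_of_cellB_of_algebraicInvariantsEq
    (hWu : thm16_charIdeal_dvd_multiplicative_of_reducible)
    (W : WeierstrassCurve ℚ) [W.IsElliptic] [W.IsGloballyMinimal] (p : ℕ) [Fact p.Prime]
    (hc : CellB W p) {n k : ℕ} (hμ0 : AnalyticMuLE W p 0) (hlam : AnalyticLambdaEq W p n)
    (hinv : AlgebraicInvariantsEq W p k)
    (hkN : ¬ W.HasSplitMultiplicativeReductionAtPrime p → n ≤ k)
    (hkS : W.HasSplitMultiplicativeReductionAtPrime p → n ≤ k + 1) : MissingInputB W p :=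
  mazurMainConjectureAt_of_algebraicInvariantsEq hWu W p hc.2.1.1 hc.2.1.2.2 hc.2.1.2.1 hμ0 hlam hinv
    hkN hkS

/-- **Sub-cell X2c (rank `1`): the CYCLOTOMIC main conjecture at the pair** from `μ_an = 0`,
`λ_an = n`, `(μ_alg, λ_alg) = (0, k)`, `n ≤ k + e_p` — main-conjecture instances at rank-one
multiplicative Eisenstein pairs (census `p = 3`: 21 X2c pairs beyond lamMin/P/T, e.g. `858b1@3` from
`66a1@3`); `BSD(E,p)` there is NOT claimed from these data (it needs the regulator valuation,
`X2/RankOneRegulatorBSD.lean`). [cite: Wuthrich2014, Thm. 16 (p. 397)] [cite: GreenbergVatsal2000, §2 p. 27] -/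
theorem cellC_mazurMainConjectureAt_of_algebraicInvariantsEq
    (hWu : thm16_charIdeal_dvd_multiplicative_of_reducible)
    (W : WeierstrassCurve ℚ) [W.IsElliptic] [W.IsGloballyMinimal] (p : ℕ) [Fact p.Prime]
    (hc : CellC W p) {n k : ℕ} (hμ0 : AnalyticMuLE W p 0) (hlam : AnalyticLambdaEq W p n)
    (hinv : AlgebraicInvariantsEq W p k)
    (hkN : ¬ W.HasSplitMultiplicativeReductionAtPrime p → n ≤ k)
    (hkS : W.HasSplitMultiplicativeReductionAtPrime p → n ≤ k + 1) :
    X2.MazurMainConjectureAt W p :=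
  mazurMainConjectureAt_of_algebraicInvariantsEq hWu W p hc.2.1 hc.2.2.2 hc.2.2.1 hμ0 hlam hinv hkN hkS

end Forms

/-! ## §2. X2 TARGET with a CLOSED RELATIVE: the transferred invariants and the headline -/

section Relative

variable {W W' : WeierstrassCurve ℚ} [W.IsElliptic] [W.IsGloballyMinimal]
  [W'.IsElliptic] [W'.IsGloballyMinimal] {p : ℕ} [Fact p.Prime]

/-- **X2 target, closed X2 relative ⇒ `(μ_alg, λ_alg)(E₀) = (0, k)`.** Target `(E₀,p)`: `p ≠ 2`
multiplicative, `E₀[p]` reducible, `μ_an = 0`. Relative `(E₀',p)`: multiplicative at `p`, Mazur's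
main conjecture at the pair (`X2.MazurMainConjectureAt W' p`), `μ_an = 0`, `λ_an = n'`, hence
invariants `(0, k')` with `k' + e_p(E₀') = n'` (`hk'N`, `hk'S`). Congruence: `E₀[p] ≅ E₀'[p]`,
`CongruentLambdaShift W W' p e`, `k = k' + e`. [cite: GreenbergVatsal2000, §2 Prop. (2.8), Cor. (2.3), Prop. (2.4), pp. 14–15, 26–27]
[cite: Wuthrich2014, Thm. 16 (p. 397)] -/
theorem algebraicInvariantsEq_of_closedRelative_mult
    (hWu : thm16_charIdeal_dvd_multiplicative_of_reducible)
    (hpar : nonempty_modularParametrizationData) (hp2 : p ≠ 2)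
    (hmult : W.HasMultiplicativeReductionAtPrime p) (hred : ¬ W.HasIrreducibleModPGaloisRep p)
    (hμ0 : AnalyticMuLE W p 0)
    (hmult' : W'.HasMultiplicativeReductionAtPrime p) (hMC' : X2.MazurMainConjectureAt W' p)
    {n' k' : ℕ} (hμ0' : AnalyticMuLE W' p 0) (hlam' : AnalyticLambdaEq W' p n')
    (hk'N : ¬ W'.HasSplitMultiplicativeReductionAtPrime p → k' = n')
    (hk'S : W'.HasSplitMultiplicativeReductionAtPrime p → k' + 1 = n')
    (hiso : TorsionIso W W' p) {e : ℤ} (hG : CongruentLambdaShift W W' p e) {k : ℕ}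
    (hk : (k : ℤ) = k' + e) : AlgebraicInvariantsEq W p k :=
  algebraicInvariantsEq_of_congruentLambdaShift hWu hpar hp2 hmult hred hμ0
    (algebraicInvariantsEq_of_mazurMainConjectureAt hpar W' p hmult' hMC' hμ0' hlam' hk'N hk'S)
    hiso hG hk

/-- **X2 target, closed X1 relative ⇒ `(μ_alg, λ_alg)(E₀) = (0, k)`.** Relative `(E₀',p)`: good
ordinary Eisenstein (`hgood' hord' hred'`), Mazur's main conjecture (`MazurMainConjecture W' p`),
`μ_an = 0`, `λ_an = n'` (X1 analytic certificates), hence invariants `(0, n')`; `k = n' + e`.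
[cite: GreenbergVatsal2000, §2 Prop. (2.8), Cor. (2.3), Prop. (2.4), pp. 14–15, 26–27]
[cite: Wuthrich2014, Thm. 16 (p. 397)] -/
theorem algebraicInvariantsEq_of_closedRelative_goodOrd
    (hWu : thm16_charIdeal_dvd_multiplicative_of_reducible)
    (hW16 : Wuthrich2014.charIdeal_dvd_padicLFunction)
    (hpar : nonempty_modularParametrizationData) (hp2 : p ≠ 2)
    (hmult : W.HasMultiplicativeReductionAtPrime p) (hred : ¬ W.HasIrreducibleModPGaloisRep p)
    (hμ0 : AnalyticMuLE W p 0)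
    (hgood' : W'.HasGoodReductionAtPrime p) (hord' : ¬ (p : ℤ) ∣ W'.frobeniusTrace p)
    (hred' : ¬ W'.HasIrreducibleModPGaloisRep p) (hMC' : MazurMainConjecture W' p) {n' : ℕ}
    (hμ0' : X1.MuPart.AnalyticMuLE W' p 0) (hlam' : X1.ParitySqueeze.AnalyticLambdaEq W' p n')
    (hiso : TorsionIso W W' p) {e : ℤ} (hG : CongruentLambdaShift W W' p e) {k : ℕ}
    (hk : (k : ℤ) = n' + e) : AlgebraicInvariantsEq W p k :=
  algebraicInvariantsEq_of_congruentLambdaShift hWu hpar hp2 hmult hred hμ0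
    (algebraicInvariantsEq_of_mazurMainConjecture hW16 hpar W' p hp2 hgood' hord' hred' hMC' hμ0' hlam')
    hiso hG hk

/-- **HEADLINE (rank `0`, closed X2 relative): `BSD(E₀, p)`** at an odd multiplicative Eisenstein
prime of analytic rank `0` from `μ_an(E₀) = 0`, `λ_an(E₀) = n`, a closed multiplicative relative
`E₀'` (Mazur's MC at `(E₀',p)`, `μ_an = 0`, `λ_an = n'`, `k' + e_p(E₀') = n'`), `E₀[p] ≅ E₀'[p]`, the
Greenberg–Vatsal transfer `λ(E₀) = λ(E₀') + e` and `n ≤ k' + e + e_p(E₀)` (then `=`). Census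
(`N < 2·10⁴`, `p = 3`): `1452e1@3`, `1716b1@3`, …, 18 X2b pairs from the route-P pair `66a1@3` alone.
[cite: GreenbergVatsal2000, §2 pp. 14–15, 26–27] [cite: Wuthrich2014, Thm. 16 (p. 397)]
[cite: SteinWuthrich2013, Thm. 6.1 (p. 20)] -/
theorem bsdp_of_closedRelative_mult_rankZero
    (hWu : thm16_charIdeal_dvd_multiplicative_of_reducible)
    (hJs : thm61_splitMultiplicative) (hJn : thm61_nonsplitMultiplicative)
    (hHs : exists_isSplitMultCanonical) (hHn : exists_isMultCanonical)
    (hGZK : rank_eq_analyticRank_of_analyticRank_le_one) (hmod : hasEntireLFunction_rat)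
    (hpar : nonempty_modularParametrizationData)
    (W W' : WeierstrassCurve ℚ) [W.IsElliptic] [W.IsGloballyMinimal] [W'.IsElliptic]
    [W'.IsGloballyMinimal] (p : ℕ) [Fact p.Prime] (hGS : greenberg_stevens (W := W) (p := p))
    (hp2 : p ≠ 2) (hmult : W.HasMultiplicativeReductionAtPrime p)
    (hred : ¬ W.HasIrreducibleModPGaloisRep p) (hr : W.analyticRank = 0) {n : ℕ}
    (hμ0 : AnalyticMuLE W p 0) (hlam : AnalyticLambdaEq W p n)
    (hmult' : W'.HasMultiplicativeReductionAtPrime p) (hMC' : X2.MazurMainConjectureAt W' p)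
    {n' k' : ℕ} (hμ0' : AnalyticMuLE W' p 0) (hlam' : AnalyticLambdaEq W' p n')
    (hk'N : ¬ W'.HasSplitMultiplicativeReductionAtPrime p → k' = n')
    (hk'S : W'.HasSplitMultiplicativeReductionAtPrime p → k' + 1 = n')
    (hiso : TorsionIso W W' p) {e : ℤ} (hG : CongruentLambdaShift W W' p e) {k : ℕ}
    (hk : (k : ℤ) = k' + e)
    (hkN : ¬ W.HasSplitMultiplicativeReductionAtPrime p → n ≤ k)
    (hkS : W.HasSplitMultiplicativeReductionAtPrime p → n ≤ k + 1) : BSDp W p :=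
  bsdp_of_algebraicInvariantsEq_rankZero hWu hJs hJn hHs hHn hGZK hmod hpar W p hGS hp2 hmult hred hr
    hμ0 hlam (algebraicInvariantsEq_of_closedRelative_mult hWu hpar hp2 hmult hred hμ0 hmult' hMC' hμ0'
      hlam' hk'N hk'S hiso hG hk) hkN hkS

/-- **HEADLINE (rank `0`, closed X1 relative): `BSD(E₀, p)`** at an odd multiplicative Eisenstein
prime of analytic rank `0` from `μ_an(E₀) = 0`, `λ_an(E₀) = n`, a closed GOOD ORDINARY Eisenstein
relative `E₀'` (Mazur's MC, `μ_an = 0`, `λ_an = n'`), `E₀[p] ≅ E₀'[p]`, the transfer and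
`n ≤ n' + e + e_p(E₀)`. Census (`p = 3`): `6510bd1@3` and `14322l1@3` from the leaf pair `434b1@3`,
`14874b1@3` from `670b1@3`. [cite: GreenbergVatsal2000, §2 pp. 14–15, 26–27]
[cite: Wuthrich2014, Thm. 16 (p. 397)] [cite: SteinWuthrich2013, Thm. 6.1 (p. 20)] -/
theorem bsdp_of_closedRelative_goodOrd_rankZero
    (hWu : thm16_charIdeal_dvd_multiplicative_of_reducible)
    (hW16 : Wuthrich2014.charIdeal_dvd_padicLFunction)
    (hJs : thm61_splitMultiplicative) (hJn : thm61_nonsplitMultiplicative)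
    (hHs : exists_isSplitMultCanonical) (hHn : exists_isMultCanonical)
    (hGZK : rank_eq_analyticRank_of_analyticRank_le_one) (hmod : hasEntireLFunction_rat)
    (hpar : nonempty_modularParametrizationData)
    (W W' : WeierstrassCurve ℚ) [W.IsElliptic] [W.IsGloballyMinimal] [W'.IsElliptic]
    [W'.IsGloballyMinimal] (p : ℕ) [Fact p.Prime] (hGS : greenberg_stevens (W := W) (p := p))
    (hp2 : p ≠ 2) (hmult : W.HasMultiplicativeReductionAtPrime p)
    (hred : ¬ W.HasIrreducibleModPGaloisRep p) (hr : W.analyticRank = 0) {n : ℕ}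
    (hμ0 : AnalyticMuLE W p 0) (hlam : AnalyticLambdaEq W p n)
    (hgood' : W'.HasGoodReductionAtPrime p) (hord' : ¬ (p : ℤ) ∣ W'.frobeniusTrace p)
    (hred' : ¬ W'.HasIrreducibleModPGaloisRep p) (hMC' : MazurMainConjecture W' p) {n' : ℕ}
    (hμ0' : X1.MuPart.AnalyticMuLE W' p 0) (hlam' : X1.ParitySqueeze.AnalyticLambdaEq W' p n')
    (hiso : TorsionIso W W' p) {e : ℤ} (hG : CongruentLambdaShift W W' p e) {k : ℕ}
    (hk : (k : ℤ) = n' + e)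
    (hkN : ¬ W.HasSplitMultiplicativeReductionAtPrime p → n ≤ k)
    (hkS : W.HasSplitMultiplicativeReductionAtPrime p → n ≤ k + 1) : BSDp W p :=
  bsdp_of_algebraicInvariantsEq_rankZero hWu hJs hJn hHs hHn hGZK hmod hpar W p hGS hp2 hmult hred hr
    hμ0 hlam (algebraicInvariantsEq_of_closedRelative_goodOrd hWu hW16 hpar hp2 hmult hred hμ0 hgood'
      hord' hred' hMC' hμ0' hlam' hiso hG hk) hkN hkS

end Relative

/-! ## §3. X1 TARGET (the good-ordinary leaf) with the exact invariants — e.g. from a closed X2 relative -/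

section LeafTarget

variable {W : WeierstrassCurve ℚ} [W.IsElliptic] [W.IsGloballyMinimal] {p : ℕ} [Fact p.Prime]

/-- **λ-part at a good ordinary Eisenstein pair from the EXACT invariants**: `(μ_alg, λ_alg) = (0, k)`
(`AlgebraicInvariantsEq W p k`, e.g. by `algebraicInvariantsEq_of_congruentLambdaShift_goodOrd` from
a closed X2 relative), `λ_an = n` (`X1.ParitySqueeze.AnalyticLambdaEq W p n`) and `n ≤ k` ⇒
`X1.MuLambda.LambdaPartAt W p` (`λ(g·h) = n ≤ k = λ(X) = λ(g)`; Wuthrich Thm. 16 `hW16` for the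
torsion, Rohrlich for `g·h ≠ 0`). [cite: GreenbergVatsal2000, §2 p. 27] [cite: Wuthrich2014, Thm. 16 (p. 397)] -/
theorem lambdaPartAt_of_algebraicInvariantsEq
    (hW16 : Wuthrich2014.charIdeal_dvd_padicLFunction) (hp : p ≠ 2)
    (hgood : W.HasGoodReductionAtPrime p) (hord : ¬ (p : ℤ) ∣ W.frobeniusTrace p)
    (hred : ¬ W.HasIrreducibleModPGaloisRep p) {k n : ℕ} (hinv : AlgebraicInvariantsEq W p k)
    (hlam : X1.ParitySqueeze.AnalyticLambdaEq W p n) (hn : n ≤ k) :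
    X1.MuLambda.LambdaPartAt W p := by
  intro κ γ hκ hγ hγ' _ f hf ϖ hϖ D g h hchar hι
  haveI : Module.Finite (IwasawaAlgebra p) D.X := D.module_finite_holds hγ
  obtain ⟨hX, -⟩ := hW16 W p hp ⟨hgood, hord⟩ hred hκ hγ hγ' hf D ϖ hϖ
  have hgh : g * h ≠ 0 := mul_ne_zero_of_iota_eq hgood hord hf hϖ D hι
  have hg : g ≠ 0 := fun h0 ↦ hgh (by rw [h0, zero_mul])
  have h1 : lam (g * h) = n := hlam f hf ϖ hϖ (g * h) hι
  have h2 : lam g = k :=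
    (lam_generator_eq_lambdaInvariant D.X hX hg hchar).trans (hinv κ γ hκ hγ hγ' D).2.2
  rw [h1, h2]; exact hn

/-- **Mazur's main conjecture at a good ordinary Eisenstein pair from the exact invariants**:
`μ_an = 0` (`X1.MuPart.AnalyticMuLE W p 0`, the μ-part), `(μ_alg, λ_alg) = (0, k)`, `λ_an = n ≤ k`
⇒ `MazurMainConjecture W p` (by `X1.MuLambda.mazurMainConjecture_iff_muPart_and_lambdaPart`).
[cite: GreenbergVatsal2000, §2 p. 27 and p. 4] [cite: Wuthrich2014, Thm. 16 (p. 397)] -/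
theorem mazurMainConjecture_of_algebraicInvariantsEq
    (hW16 : Wuthrich2014.charIdeal_dvd_padicLFunction) (hp : p ≠ 2)
    (hgood : W.HasGoodReductionAtPrime p) (hord : ¬ (p : ℤ) ∣ W.frobeniusTrace p)
    (hred : ¬ W.HasIrreducibleModPGaloisRep p) {k n : ℕ} (hμ0 : X1.MuPart.AnalyticMuLE W p 0)
    (hinv : AlgebraicInvariantsEq W p k) (hlam : X1.ParitySqueeze.AnalyticLambdaEq W p n)
    (hn : n ≤ k) : MazurMainConjecture W p :=
  (mazurMainConjecture_iff_muPart_and_lambdaPart hW16 hp hgood hord hred).mpr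
    ⟨muPartAt_of_analyticMuLE_zero hW16 hp hgood hord hred hμ0,
      lambdaPartAt_of_algebraicInvariantsEq hW16 hp hgood hord hred hinv hlam hn⟩

/-- **On the X1 leaf (`ClassX1 ∧ r_an = 0`): `BSD(E₀, p)` from the exact invariants** —
`μ_an(E₀) = 0`, `(μ_alg, λ_alg)(E₀) = (0, k)` (e.g. transferred from a closed X2 relative by
`algebraicInvariantsEq_of_congruentLambdaShift_goodOrd`), `λ_an(E₀) = n ≤ k`; through
`X1.RankZero.Leaf.mazurMainConjecture_iff_bsdp` (Greenberg Thm. 4.1, modularity, GZK, all PUBLISHED).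
Census (`p = 3`): 30 rank-0 X1 classes close only through an X2 relative, 20 of them (the `44a`
family: `44a1, 242b1, 286a1, …`) from the route-P pair `66a1@3`.
[cite: GreenbergVatsal2000, §2 p. 27] [cite: GreenbergLNM1716, Thm. 4.1] [cite: Wuthrich2014, Thm. 16 (p. 397)] -/
theorem Leaf.bsdp_of_algebraicInvariantsEq
    (hW16 : Wuthrich2014.charIdeal_dvd_padicLFunction) (hGr : greenberg_charValue_rankZero)
    (hmod : nonempty_modularParametrizationData)
    (hGZK : rank_eq_analyticRank_of_analyticRank_le_one) (hL : X1.RankZero.Leaf W p) {k n : ℕ}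
    (hμ0 : X1.MuPart.AnalyticMuLE W p 0) (hinv : AlgebraicInvariantsEq W p k)
    (hlam : X1.ParitySqueeze.AnalyticLambdaEq W p n) (hn : n ≤ k) : BSDp W p :=
  have hX := isClassX1_of_classX1 hL.classX1
  (X1.RankZero.Leaf.mazurMainConjecture_iff_bsdp hW16 hGr hmod hGZK hL).mp
    (mazurMainConjecture_of_algebraicInvariantsEq hW16 hX.two_ne hX.hasGoodReductionAtPrime
      hX.not_dvd_frobeniusTrace hX.not_hasIrreducibleModPGaloisRep hμ0 hinv hlam hn)

/-- **On the X1 leaf with a closed X2 relative: `BSD(E₀, p)`** — target `(E₀,p)` on the leaf with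
`μ_an = 0`, `λ_an = n`; relative `(E₀',p)` multiplicative with Mazur's MC at the pair, `μ_an = 0`,
`λ_an = n'`, `k' + e_p(E₀') = n'`; `E₀[p] ≅ E₀'[p]`, `CongruentLambdaShift W W' p e`, `k = k' + e`,
`n ≤ k`. [cite: GreenbergVatsal2000, §2 pp. 14–15, 26–27] [cite: GreenbergLNM1716, Thm. 4.1]
[cite: Wuthrich2014, Thm. 16 (p. 397)] -/
theorem Leaf.bsdp_of_closedRelative_mult {W' : WeierstrassCurve ℚ} [W'.IsElliptic]
    [W'.IsGloballyMinimal]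
    (hW16 : Wuthrich2014.charIdeal_dvd_padicLFunction) (hGr : greenberg_charValue_rankZero)
    (hmod : nonempty_modularParametrizationData)
    (hGZK : rank_eq_analyticRank_of_analyticRank_le_one) (hL : X1.RankZero.Leaf W p) {n : ℕ}
    (hμ0 : X1.MuPart.AnalyticMuLE W p 0) (hlam : X1.ParitySqueeze.AnalyticLambdaEq W p n)
    (hmult' : W'.HasMultiplicativeReductionAtPrime p) (hMC' : X2.MazurMainConjectureAt W' p)
    {n' k' : ℕ} (hμ0' : AnalyticMuLE W' p 0) (hlam' : AnalyticLambdaEq W' p n')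
    (hk'N : ¬ W'.HasSplitMultiplicativeReductionAtPrime p → k' = n')
    (hk'S : W'.HasSplitMultiplicativeReductionAtPrime p → k' + 1 = n')
    (hiso : TorsionIso W W' p) {e : ℤ} (hG : CongruentLambdaShift W W' p e) {k : ℕ}
    (hk : (k : ℤ) = k' + e) (hn : n ≤ k) : BSDp W p :=
  have hX := isClassX1_of_classX1 hL.classX1
  Leaf.bsdp_of_algebraicInvariantsEq hW16 hGr hmod hGZK hL hμ0
    (algebraicInvariantsEq_of_congruentLambdaShift_goodOrd hW16 hmod hX.two_ne
      hX.hasGoodReductionAtPrime hX.not_dvd_frobeniusTrace hX.not_hasIrreducibleModPGaloisRep hμ0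
      (algebraicInvariantsEq_of_mazurMainConjectureAt hmod W' p hmult' hMC' hμ0' hlam' hk'N hk'S)
      hiso hG hk) hlam hn

end LeafTarget

end Summit.BirchSwinnertonDyer.Rank1Residual.X2

end
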